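import Literature.GroupTheory.ArithmeticGroups.IharaAmalgamLift
import Literature.GroupTheory.ArithmeticGroups.IharaAmalgamGeneration
import Literature.GroupTheory.ArithmeticGroups.ElementaryBoundedGeneration
import Literature.NumberTheory.Automorphic.CongruenceSubgroupPropertySL2AwayHolds
import Mathlib.LinearAlgebra.Matrix.GeneralLinearGroup.Defs
import HarnessLib

/-!
# Ihara's amalgam — IV: the two-sided congruence kernel (amalgam + congruence subgroup property for `SL₂(ℤ[1/p])`)

Topic `Literature/GroupTheory/ArithmeticGroups`; namespace `Literature.GroupTheory.ArithmeticGroups.IharaAmalgam`.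
PROOF-ONLY file (no definition, no named fact; D-0026), sequel of `IharaAmalgam{PingPong,Lift,Generation}.lean`.
It proves the "amalgam + congruence subgroup property" sentence that the Calegari–Dimitrov–Tang formalisation
consumes as hypothesis `hker₂` (`CalegariDimitrovTang2025_unboundedDenominators.of_two_inputs`; CDT, J. AMS 38
(2025), Lemma 4.4.1 (Serre–Berger) proof and Lemma 4.6.2 = Ihara's lemma in Ribet's form): for a prime `p ∤ N`,
`A = diag(p, 1)`, and two homomorphisms `g₁, g₂ : Γ(N) → Δ` (`Δ` finite) with `g₁ x = g₂ (A x A⁻¹)` on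
`Γ(N) ∩ Γ₀(p)`, both `g₁` and `g₂` kill some `Γ(N) ∩ Γ(M)`, `M ≠ 0` — `exists_level_of_intertwined`.  (The same
theorem was first landed Summits-side as the K★ stub `…Theorems.StarredOptimalManinUnitFiveSevenHker2.stub_hker2`;
this is its Literature home, importable by every consumer of the CDT theorem, e.g. `UnboundedDenominatorsOfCor453`.)

Proof (all inputs are theorems of the tree):
* IHARA'S THEOREM `IharaAmalgam.exists_hom_sup` (ping-pong on `ℙ¹(ℚ)`, Serre *Trees* II.1.4): `g₁` and
  `g₂ ∘ (A · A⁻¹)` glue to `F : ⟨Γ(N), A⁻¹ Γ(N) A⟩ → Δ` in `GL₂(ℚ)`;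
* GENERATION `IharaAmalgam.toGL_map_mem_sup`: `⟨Γ(N), A⁻¹ Γ(N) A⟩` contains the image of the principal congruence
  subgroup `Γ̃(N) = SL2Rel.Gamma (N)` of `SL₂(ℤ[1/p])`; pulling `F` back gives `Γ̃(N) → Δ` with kernel of finite
  index in `SL₂(ℤ[1/p])` (`finite_quotient_away_span_natCast`);
* the CONGRUENCE SUBGROUP PROPERTY of `SL₂(ℤ[1/p])` (`SerreSL2Congruence1970_congruenceSubgroupProperty_away_holds`,
  Serre 1970 / Mennicke 1967, PROVED in the tree; consumer form `exists_level_forall_dvd_imp_mem`): that kernel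
  contains `Γ̃(M)`; finally `Γ(N) ∩ Γ(M) ↪ Γ̃(M)` directly and through `y ↦ A⁻¹ y A`.

## References

* [CalegariDimitrovTang2025] F. Calegari, V. Dimitrov, Y. Tang, J. Amer. Math. Soc. 38 (2025), Lemma 4.4.1, Lemma 4.6.2.
* [Serre1980Trees] J.-P. Serre, *Trees*, II.1.4 Thm. 3 and Cor. 1.
* [SerreSL2Congruence1970] J.-P. Serre, Ann. of Math. 92 (1970), §2.6 Thm. 2 (b), Cor. 3.
-/

set_option autoImplicit false

noncomputable section

open scoped MatrixGroups
open CongruenceSubgroup Matrix.SpecialLinearGroup Literature.NumberTheory.Automorphic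

namespace Literature.GroupTheory.ArithmeticGroups.IharaAmalgam

/-! ### Bookkeeping between the real and the rational `A = diag(p, 1)` -/

/-- Entry relations from `A x = y A` over `ℚ` (`p ≠ 0`). [folklore] -/
private lemma entries_of_diag_mul_eq {p : ℕ} (hp : p ≠ 0) {A : GL (Fin 2) ℚ}
    (hA : (A : Matrix (Fin 2) (Fin 2) ℚ) = !![(p : ℚ), 0; 0, 1]) {x y : SL(2, ℤ)}
    (h : A * mapGL ℚ x = mapGL ℚ y * A) :
    y 0 0 = x 0 0 ∧ y 0 1 = p * x 0 1 ∧ (p : ℤ) * y 1 0 = x 1 0 ∧ y 1 1 = x 1 1 := by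
  have hp' : (p : ℚ) ≠ 0 := by exact_mod_cast hp
  have hv := congrArg (fun g : GL (Fin 2) ℚ ↦ (g : Matrix (Fin 2) (Fin 2) ℚ)) h
  simp only [Units.val_mul, hA] at hv
  have e := fun i j ↦ congrFun (congrFun hv i) j
  have h00 := e 0 0; have h01 := e 0 1; have h10 := e 1 0; have h11 := e 1 1
  simp [Matrix.mul_apply, Fin.sum_univ_two] at h00 h01 h10 h11
  refine ⟨?_, ?_, ?_, ?_⟩
  · have : ((y 0 0 : ℤ) : ℚ) = x 0 0 := mul_right_cancel₀ hp' (by linear_combination h00.symm)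
    exact_mod_cast this
  · exact_mod_cast h01.symm
  · have : (p : ℚ) * y 1 0 = x 1 0 := by linear_combination h10.symm
    exact_mod_cast this
  · exact_mod_cast h11.symm

/-- The real equation `A x = y A` from the entry relations (`A = diag(p, 1) ∈ GL₂(ℝ)`). [folklore] -/
private lemma real_diag_mul_eq {p : ℕ} {A : GL (Fin 2) ℝ}
    (hA : (A : Matrix (Fin 2) (Fin 2) ℝ) = !![(p : ℝ), 0; 0, 1]) {x y : SL(2, ℤ)}
    (h00 : y 0 0 = x 0 0) (h01 : y 0 1 = p * x 0 1) (h10 : (p : ℤ) * y 1 0 = x 1 0)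
    (h11 : y 1 1 = x 1 1) : A * mapGL ℝ x = mapGL ℝ y * A := by
  have r00 : ((y 0 0 : ℤ) : ℝ) = x 0 0 := by exact_mod_cast h00
  have r01 : ((y 0 1 : ℤ) : ℝ) = p * x 0 1 := by exact_mod_cast h01
  have r10 : (p : ℝ) * y 1 0 = x 1 0 := by exact_mod_cast h10
  apply Units.ext
  rw [Units.val_mul, Units.val_mul, hA]
  ext i j
  fin_cases i <;> fin_cases j <;>
    simp [Matrix.mul_apply, Fin.sum_univ_two, Matrix.SpecialLinearGroup.mapGL]
  · linear_combination (p : ℝ) * r00.symm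
  · linear_combination -r01
  · linear_combination -r10
  · exact h11.symm

/-- `mapGL ℚ : SL₂(ℤ) → GL₂(ℚ)` is injective. [folklore] -/
private lemma mapGL_rat_injective : Function.Injective (mapGL ℚ : SL(2, ℤ) →* GL (Fin 2) ℚ) := by
  intro x y h
  ext i j
  have := congrArg (fun g : GL (Fin 2) ℚ ↦ (g : Matrix (Fin 2) (Fin 2) ℚ) i j) h
  simpa [mapGL_rat_apply] using this

/-- **The two-sided congruence kernel (Ihara's lemma in Ribet's form / CDT Lemma 4.6.2).**  For a prime `p ∤ N`
and `A = diag(p, 1)`, two homomorphisms `g₁, g₂ : Γ(N) → Δ` to a finite group that are intertwined by `A` on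
`Γ(N) ∩ Γ₀(p)` (`g₁ x = g₂ (A x A⁻¹)`) both have congruence kernels: some `Γ(N) ∩ Γ(M)`, `M ≠ 0`, lies in both.
Amalgam (`exists_hom_sup`, `toGL_map_mem_sup`) + congruence subgroup property of `SL₂(ℤ[1/p])`
(`SerreSL2Congruence1970_congruenceSubgroupProperty_away_holds`).
[cite: CalegariDimitrovTang2025, Lemma 4.4.1 (proof) and Lemma 4.6.2] [cite: Serre1980Trees, II.1.4 Thm. 3, Cor. 1]
[cite: SerreSL2Congruence1970, §2.6 Thm. 2 (b), Cor. 3] -/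
theorem exists_level_of_intertwined : ∀ (N p : ℕ) (A : GL (Fin 2) ℝ), 0 < N →
      (A : Matrix (Fin 2) (Fin 2) ℝ) = !![(p : ℝ), 0; 0, 1] → p.Prime → ¬ p ∣ N →
      ∀ (Δ : Type) [Group Δ] [Finite Δ] (g₁ g₂ : Gamma N →* Δ),
      (∀ (x : SL(2, ℤ)) (hx : x ∈ Gamma N), x ∈ Gamma0 p → ∀ (y : SL(2, ℤ)) (hy : y ∈ Gamma N),
        A * mapGL ℝ x = mapGL ℝ y * A → g₁ ⟨x, hx⟩ = g₂ ⟨y, hy⟩) →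
      (∃ M : ℕ, M ≠ 0 ∧ ∀ (x : SL(2, ℤ)) (hx : x ∈ Gamma N), x ∈ Gamma M → g₁ ⟨x, hx⟩ = 1) ∧
      (∃ M : ℕ, M ≠ 0 ∧ ∀ (x : SL(2, ℤ)) (hx : x ∈ Gamma N), x ∈ Gamma M → g₂ ⟨x, hx⟩ = 1) := by
  intro N p A hN hA hp hpN Δ _ _ g₁ g₂ hcompat
  haveI : Fact p.Prime := ⟨hp⟩
  have hNp : N.Coprime p := ((Nat.Prime.coprime_iff_not_dvd hp).mpr hpN).symm
  have hp0 : (p : ℚ) ≠ 0 := by exact_mod_cast hp.ne_zero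
  -- the rational `A' = diag(p, 1)` and the two vertex groups `K₀ = Γ(N)`, `K₁ = A'⁻¹ Γ(N) A'`
  let A' : GL (Fin 2) ℚ := Matrix.GeneralLinearGroup.mkOfDetNeZero !![(p : ℚ), 0; 0, 1]
    (by rw [Matrix.det_fin_two_of]; simp [hp.ne_zero])
  have hA' : (A' : Matrix (Fin 2) (Fin 2) ℚ) = !![(p : ℚ), 0; 0, 1] := rfl
  let ι₀ : SL(2, ℤ) →* GL (Fin 2) ℚ := mapGL ℚ
  let ι₁ : SL(2, ℤ) →* GL (Fin 2) ℚ := (MulAut.conj A'⁻¹).toMonoidHom.comp (mapGL ℚ)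
  have hι₁ : ∀ γ, ι₁ γ = A'⁻¹ * mapGL ℚ γ * A' := fun γ ↦ by
    simp [ι₁]
  have hι₀inj : Function.Injective ι₀ := mapGL_rat_injective
  have hι₁inj : Function.Injective ι₁ := (MulAut.conj A'⁻¹).injective.comp mapGL_rat_injective
  let K₀ : Subgroup (GL (Fin 2) ℚ) := (Gamma N).map ι₀
  let K₁ : Subgroup (GL (Fin 2) ℚ) := (Gamma N).map ι₁
  have hK₀ : ∀ g, g ∈ K₀ ↔ ∃ γ ∈ Gamma N, mapGL ℚ γ = g := fun g ↦ Subgroup.mem_map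
  have hK₁ : ∀ g, g ∈ K₁ ↔ A' * g * A'⁻¹ ∈ K₀ := by
    intro g
    rw [hK₀]
    constructor
    · rintro ⟨γ, hγ, rfl⟩
      exact ⟨γ, hγ, by rw [hι₁]; group⟩
    · rintro ⟨γ, hγ, h⟩
      exact ⟨γ, hγ, by rw [hι₁, h]; group⟩
  -- the two homomorphisms on `K₀`, `K₁`
  let e₀ := (Gamma N).equivMapOfInjective ι₀ hι₀inj
  let e₁ := (Gamma N).equivMapOfInjective ι₁ hι₁inj
  let f₀ : ↥K₀ →* Δ := g₁.comp e₀.symm.toMonoidHom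
  let f₁ : ↥K₁ →* Δ := g₂.comp e₁.symm.toMonoidHom
  have hf₀ : ∀ γ (hγ : γ ∈ Gamma N) (h : ι₀ γ ∈ K₀), f₀ ⟨ι₀ γ, h⟩ = g₁ ⟨γ, hγ⟩ := by
    intro γ hγ h
    simp only [f₀, MonoidHom.coe_comp, Function.comp_apply, MulEquiv.coe_toMonoidHom]
    congr 1
    rw [MulEquiv.symm_apply_eq]
    exact Subtype.ext rfl
  have hf₁ : ∀ γ (hγ : γ ∈ Gamma N) (h : ι₁ γ ∈ K₁), f₁ ⟨ι₁ γ, h⟩ = g₂ ⟨γ, hγ⟩ := by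
    intro γ hγ h
    simp only [f₁, MonoidHom.coe_comp, Function.comp_apply, MulEquiv.coe_toMonoidHom]
    congr 1
    rw [MulEquiv.symm_apply_eq]
    exact Subtype.ext rfl
  -- they agree on the edge group (the hypothesis `hcompat`)
  have hf : ∀ (g : GL (Fin 2) ℚ) (h₀ : g ∈ K₀) (h₁ : g ∈ K₁), f₀ ⟨g, h₀⟩ = f₁ ⟨g, h₁⟩ := by
    intro g h₀ h₁
    obtain ⟨x, hx, rfl⟩ := (hK₀ g).mp h₀
    obtain ⟨y, hy, hyx⟩ := Subgroup.mem_map.mp h₁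
    have hAxy : A' * mapGL ℚ x = mapGL ℚ y * A' := by
      rw [hι₁] at hyx
      rw [← hyx]; group
    obtain ⟨h00, h01, h10, h11⟩ := entries_of_diag_mul_eq hp.ne_zero hA' hAxy
    have hx0 : x ∈ Gamma0 p := by
      rw [Gamma0_mem]
      exact (ZMod.intCast_zmod_eq_zero_iff_dvd _ p).mpr ⟨y 1 0, h10.symm⟩
    have e1 : f₀ ⟨mapGL ℚ x, h₀⟩ = g₁ ⟨x, hx⟩ := hf₀ x hx h₀
    have e2 : f₁ ⟨mapGL ℚ x, h₁⟩ = g₂ ⟨y, hy⟩ := by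
      have : (⟨mapGL ℚ x, h₁⟩ : ↥K₁) = ⟨ι₁ y, Subgroup.mem_map_of_mem _ hy⟩ := Subtype.ext hyx.symm
      rw [this, hf₁ y hy]
    rw [e1, e2]
    exact hcompat x hx hx0 y hy (real_diag_mul_eq hA h00 h01 h10 h11)
  -- IHARA: glue to `F` on `K₀ ⊔ K₁`
  obtain ⟨F, hF₀, hF₁⟩ := exists_hom_sup hNp hA' hK₀ hK₁ f₀ f₁ hf
  -- `SL₂(ℤ[1/p])`, its level-`N` congruence subgroup, and the pull-back of `F`
  let θ : Localization.Away (p : ℤ) →+* ℚ := IsLocalization.Away.lift (p : ℤ)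
    (g := Int.castRingHom ℚ) (by simpa using hp0)
  let θhat : SL(2, Localization.Away (p : ℤ)) →* GL (Fin 2) ℚ :=
    (Matrix.SpecialLinearGroup.toGL).comp (Matrix.SpecialLinearGroup.map θ)
  let ΓN : Subgroup SL(2, Localization.Away (p : ℤ)) :=
    SL2Rel.Gamma (Ideal.span {(N : Localization.Away (p : ℤ))})
  have hmem : ∀ g, g ∈ ΓN → θhat g ∈ K₀ ⊔ K₁ := fun g hg ↦
    toGL_map_mem_sup hNp hA' hK₀ hK₁ θ g hg
  let h : ↥ΓN →* Δ :=
    F.comp ((θhat.comp ΓN.subtype).codRestrict (K₀ ⊔ K₁) (fun g ↦ hmem g g.2))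
  have hh : ∀ g : ↥ΓN, h g = F ⟨θhat g, hmem g g.2⟩ := fun g ↦ rfl
  let H : Subgroup SL(2, Localization.Away (p : ℤ)) := h.ker.map ΓN.subtype
  -- `H` has finite index in `SL₂(ℤ[1/p])`
  have hΓN : ΓN.index ≠ 0 := by
    haveI : Finite (Localization.Away (p : ℤ) ⧸ Ideal.span {(N : Localization.Away (p : ℤ))}) :=
      finite_quotient_away_span_natCast hN.ne'
    haveI : Finite SL(2, Localization.Away (p : ℤ) ⧸ Ideal.span {(N : Localization.Away (p : ℤ))}) :=
      Finite.of_injective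
        (fun g : SL(2, Localization.Away (p : ℤ) ⧸ Ideal.span {(N : Localization.Away (p : ℤ))}) ↦
          (g : Matrix (Fin 2) (Fin 2) (Localization.Away (p : ℤ) ⧸ Ideal.span {(N : Localization.Away (p : ℤ))})))
        Subtype.coe_injective
    change (MonoidHom.ker _).index ≠ 0
    rw [Subgroup.index_ker]
    exact Nat.card_pos.ne'
  have hH : H.FiniteIndex := by
    refine ⟨?_⟩
    rw [Subgroup.index_map_subtype]
    refine mul_ne_zero ?_ hΓN
    rw [Subgroup.index_ker]
    exact Nat.card_pos.ne'
  -- CSP for `SL₂(ℤ[1/p])`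
  obtain ⟨M, hM0, hM⟩ := exists_level_forall_dvd_imp_mem
    SerreSL2Congruence1970_congruenceSubgroupProperty_away_holds hp.two_le H hH
  have hker : ∀ g, g ∈ H → ∃ y : ↥ΓN, (y : SL(2, Localization.Away (p : ℤ))) = g ∧
      F ⟨θhat y, hmem y y.2⟩ = 1 := by
    intro g hg
    obtain ⟨y, hy, rfl⟩ := Subgroup.mem_map.mp hg
    exact ⟨y, rfl, by rw [← hh]; exact hy⟩
  have hθz : ∀ z : ℤ, θ (algebraMap ℤ (Localization.Away (p : ℤ)) z) = z := fun z ↦ by simp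
  refine ⟨⟨M, hM0.ne', fun x hx hxM ↦ ?_⟩, ⟨M, hM0.ne', fun y hy hyM ↦ ?_⟩⟩
  · -- `g₁`: push `x ∈ Γ(N) ∩ Γ(M)` into `SL₂(ℤ[1/p])`
    let gx : SL(2, Localization.Away (p : ℤ)) :=
      Matrix.SpecialLinearGroup.map (algebraMap ℤ (Localization.Away (p : ℤ))) x
    obtain ⟨m00, m01, m10, m11⟩ := mem_Gamma_iff_dvd.mp hxM
    have hgxH : gx ∈ H := by
      refine hM gx fun i j ↦ ?_
      have hij : gx i j - (1 : SL(2, Localization.Away (p : ℤ))) i j =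
          algebraMap ℤ (Localization.Away (p : ℤ)) (x i j - (1 : Matrix (Fin 2) (Fin 2) ℤ) i j) := by
        rw [map_sub]
        congr 1
        fin_cases i <;> fin_cases j <;> simp
      rw [hij, ← map_natCast (algebraMap ℤ (Localization.Away (p : ℤ)))]
      apply map_dvd
      fin_cases i <;> fin_cases j
      · simpa using m00
      · simpa using m01
      · simpa using m10
      · simpa using m11
    obtain ⟨yx, hyx, hFgx⟩ := hker gx hgxH
    have hθgx : θhat gx = mapGL ℚ x := by
      apply Units.ext
      ext i j
      simp [θhat, gx, mapGL_rat_apply]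
    have hx0 : mapGL ℚ x ∈ K₀ := (hK₀ _).mpr ⟨x, hx, rfl⟩
    have key : F ⟨θhat yx, hmem yx yx.2⟩ = g₁ ⟨x, hx⟩ := by
      have : (⟨θhat yx, hmem yx yx.2⟩ : ↥(K₀ ⊔ K₁)) = ⟨mapGL ℚ x, Subgroup.mem_sup_left hx0⟩ := by
        apply Subtype.ext
        change θhat yx = mapGL ℚ x
        rw [← hθgx, hyx]
      rw [this, hF₀ _ hx0, hf₀ x hx]
    rw [← key, hFgx]
  · -- `g₂`: push `A⁻¹ y A`, `y ∈ Γ(N) ∩ Γ(M)`, into `SL₂(ℤ[1/p])`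
    let q : Localization.Away (p : ℤ) := IsLocalization.Away.invSelf (p : ℤ)
    have hpq : (p : Localization.Away (p : ℤ)) * q = 1 := by
      rw [← map_natCast (algebraMap ℤ (Localization.Away (p : ℤ))) p]
      exact IsLocalization.Away.mul_invSelf (p : ℤ)
    have hθq : θ q = (p : ℚ)⁻¹ := by
      have : θ (p : Localization.Away (p : ℤ)) * θ q = 1 := by rw [← map_mul, hpq, map_one]
      rw [map_natCast] at this
      exact eq_inv_of_mul_eq_one_right this
    have hdet : (y 0 0 : Localization.Away (p : ℤ)) * y 1 1 -
        ((y 0 1 : Localization.Away (p : ℤ)) * q) * ((p : Localization.Away (p : ℤ)) * y 1 0) = 1 := by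
      have hd : y 0 0 * y 1 1 - y 0 1 * y 1 0 = 1 := by
        have := Matrix.det_fin_two (y : Matrix (Fin 2) (Fin 2) ℤ)
        rw [y.det_coe] at this
        exact this.symm
      have hd' := congrArg (Int.cast : ℤ → Localization.Away (p : ℤ)) hd
      push_cast at hd'
      linear_combination hd' - (y 0 1 : Localization.Away (p : ℤ)) * y 1 0 * hpq
    let gy : SL(2, Localization.Away (p : ℤ)) :=
      ⟨!![((y : Matrix (Fin 2) (Fin 2) ℤ) 0 0 : Localization.Away (p : ℤ)),
          ((y : Matrix (Fin 2) (Fin 2) ℤ) 0 1 : Localization.Away (p : ℤ)) * q;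
          (p : Localization.Away (p : ℤ)) * (y : Matrix (Fin 2) (Fin 2) ℤ) 1 0,
          ((y : Matrix (Fin 2) (Fin 2) ℤ) 1 1 : Localization.Away (p : ℤ))],
        by rw [Matrix.det_fin_two_of]; exact hdet⟩
    obtain ⟨m00, m01, m10, m11⟩ := mem_Gamma_iff_dvd.mp hyM
    have castdvd : ∀ {a : ℤ}, (M : ℤ) ∣ a → (M : Localization.Away (p : ℤ)) ∣ (a : Localization.Away (p : ℤ)) :=
      fun {a} h ↦ by
      have := map_dvd (Int.castRingHom (Localization.Away (p : ℤ))) h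
      simpa using this
    have hgyH : gy ∈ H := by
      refine hM gy fun i j ↦ ?_
      fin_cases i <;> fin_cases j
      · simpa [gy] using castdvd m00
      · simpa [gy] using Dvd.dvd.mul_right (castdvd m01) q
      · simpa [gy] using Dvd.dvd.mul_left (castdvd m10) (p : Localization.Away (p : ℤ))
      · simpa [gy] using castdvd m11
    obtain ⟨yy, hyy, hFgy⟩ := hker gy hgyH
    have hθgy : θhat gy = A'⁻¹ * mapGL ℚ y * A' := by
      have e : A' * θhat gy = mapGL ℚ y * A' := by
        apply Units.ext
        rw [Units.val_mul, Units.val_mul, hA']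
        ext i j
        fin_cases i <;> fin_cases j <;>
          simp [θhat, gy, Matrix.mul_apply, Fin.sum_univ_two, hθq]
        · rw [mul_comm]
        · rw [mul_comm, mul_assoc, inv_mul_cancel₀ hp0, mul_one]
        · rw [mul_comm]
      rw [mul_assoc, eq_inv_mul_iff_mul_eq, e]
    have hy1 : ι₁ y ∈ K₁ := Subgroup.mem_map_of_mem _ hy
    have key : F ⟨θhat yy, hmem yy yy.2⟩ = g₂ ⟨y, hy⟩ := by
      have : (⟨θhat yy, hmem yy yy.2⟩ : ↥(K₀ ⊔ K₁)) = ⟨ι₁ y, Subgroup.mem_sup_right hy1⟩ := by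
        apply Subtype.ext
        change θhat yy = ι₁ y
        rw [hyy, hθgy, hι₁]
      rw [this, hF₁ _ hy1, hf₁ y hy]
    rw [← key, hFgy]

end Literature.GroupTheory.ArithmeticGroups.IharaAmalgam

end
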